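import Literature.NumberTheory.LFunctions.RudnickSarnakNPairIntegral
import Literature.NumberTheory.LFunctions.RudnickSarnakNSmoothedLimit
import HarnessLib

/-!
# Rudnick–Sarnak `n`-level correlations for `ζ`, XIX: patterns and partial matchings

Sibling file of `Literature/NumberTheory/LFunctions/RudnickSarnak.lean` (toward
`Literature.NumberTheory.LFunctions.rudnick_sarnak_unrestricted` at every level). The sum over the
patterns `(D, P, β)` of the cell limits `I_β(Φ)` (`RudnickSarnakN.pairInt`,
`RudnickSarnakN.Unsmooth.frontLimit`) is identified with the diagonal-pairing functional `∫ Φ C_O`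
of Rudnick–Sarnak 1996, (3.9) (`Literature.NumberTheory.LFunctions.rsPairingFunctional`):

  `Σ_D Σ_{P ⊆ Dᶜ} Σ_{β : P ≃ Dᶜ∖P} I_β(Φ) = ∫ Φ C_O`

(`RudnickSarnakN.sum_pairInt_eq_rsPairingFunctional`, `RudnickSarnakN.frontLimit_eq_rsPairingFunctional`).
A pattern determines the partial matching `M = {{p, βp}}` (`RudnickSarnakN.Mof`) and the orthant of
`ℝ^M` given by the signs `p ≶ βp`, i.e. by the transversal `P` of `M`; conversely each pair
(partial matching, transversal) arises from exactly one pattern (`RudnickSarnakN.card_filter_Mof_eq`),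
and for a fixed matching the orthants of its transversals fill `ℝ^M` up to the coordinate
hyperplanes (`RudnickSarnakN.sum_orthIndMP_eq_one`), a null set (Rudnick–Sarnak 1996,
(3.45)–(3.47) and (3.74): "summing over all `σ` … we get all choices of disjoint pairs, and the
integrals over `v_i > 0` and `v_i < 0` combine to give `|v_i|`"). Consequently the windowed sums
satisfy `W_Φ(T)/(T log T) → c_n ∫ Φ C_O` (`RudnickSarnakN.tendsto_zeroSideSum_div_rsPairing`).

## References

* Z. Rudnick, P. Sarnak, *Zeros of principal `L`-functions and random matrix theory*, Duke Math.
  J. 81 (1996), 269–322, (3.9), (3.45)–(3.47), (3.74).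
-/

noncomputable section

open Complex Filter Set MeasureTheory Finset
open scoped Real Topology

namespace Literature.NumberTheory.LFunctions

namespace RudnickSarnakN

variable {k : ℕ}

/-! ## Partial matchings: support, partners, transversals -/

section Matching

variable {n : ℕ} {M : Finset (Fin n × Fin n)}

/-- The support `⋃_{m ∈ M} {m.1, m.2}` of a set of pairs. [folklore] -/
def suppM (M : Finset (Fin n × Fin n)) : Finset (Fin n) := M.biUnion fun m ↦ {m.1, m.2}

/-- Membership in the support. [folklore] -/
theorem mem_suppM {j : Fin n} : j ∈ suppM M ↔ ∃ m ∈ M, j = m.1 ∨ j = m.2 := by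
  simp [suppM, Finset.mem_biUnion]

/-- In a partial matching two pairs with a common endpoint coincide. [folklore] -/
theorem eq_of_endpoint (hM : IsPartialMatching M) {m m' : Fin n × Fin n} (hm : m ∈ M) (hm' : m' ∈ M)
    {j : Fin n} (hj : j = m.1 ∨ j = m.2) (hj' : j = m'.1 ∨ j = m'.2) : m = m' := by
  by_contra hne
  have h := hM.2 (Finset.mem_coe.2 hm) (Finset.mem_coe.2 hm') hne
  simp only [Function.onFun] at h
  rw [Finset.disjoint_left] at h
  have h1 : j ∈ ({m.1, m.2} : Finset (Fin n)) := by rcases hj with rfl | rfl <;> simp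
  have h2 : j ∈ ({m'.1, m'.2} : Finset (Fin n)) := by rcases hj' with rfl | rfl <;> simp
  exact h h1 h2

/-- The endpoints of a pair of a partial matching are distinct. [folklore] -/
theorem fst_ne_snd (hM : IsPartialMatching M) {m : Fin n × Fin n} (hm : m ∈ M) : m.1 ≠ m.2 := (hM.1 m hm).ne

open scoped Classical in
/-- The partner of an index in a set of pairs (the index itself if it is unmatched). [folklore] -/
def partner (M : Finset (Fin n × Fin n)) (j : Fin n) : Fin n :=
  if h : ∃ m ∈ M, m.1 = j then (Classical.choose h).2
  else if h' : ∃ m ∈ M, m.2 = j then (Classical.choose h').1 else j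

/-- The partner of a first endpoint. [folklore] -/
theorem partner_fst (hM : IsPartialMatching M) {m : Fin n × Fin n} (hm : m ∈ M) : partner M m.1 = m.2 := by
  unfold partner
  have h : ∃ m' ∈ M, m'.1 = m.1 := ⟨m, hm, rfl⟩
  rw [dif_pos h]
  obtain ⟨hm', h1⟩ := Classical.choose_spec h
  rw [eq_of_endpoint hM hm' hm (j := m.1) (Or.inl h1.symm) (Or.inl rfl)]

/-- The partner of a second endpoint. [folklore] -/
theorem partner_snd (hM : IsPartialMatching M) {m : Fin n × Fin n} (hm : m ∈ M) : partner M m.2 = m.1 := by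
  unfold partner
  have hno : ¬ ∃ m' ∈ M, m'.1 = m.2 := by
    rintro ⟨m', hm', h1⟩
    have h := eq_of_endpoint hM hm' hm (j := m.2) (Or.inl h1.symm) (Or.inr rfl)
    rw [h] at h1
    exact fst_ne_snd hM hm h1
  rw [dif_neg hno]
  have h' : ∃ m' ∈ M, m'.2 = m.2 := ⟨m, hm, rfl⟩
  rw [dif_pos h']
  obtain ⟨hm', h2⟩ := Classical.choose_spec h'
  rw [eq_of_endpoint hM hm' hm (j := m.2) (Or.inr h2.symm) (Or.inr rfl)]

/-- `partner` is an involution on the support. [folklore] -/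
theorem partner_partner (hM : IsPartialMatching M) {j : Fin n} (hj : j ∈ suppM M) :
    partner M (partner M j) = j := by
  obtain ⟨m, hm, rfl | rfl⟩ := mem_suppM.1 hj
  · rw [partner_fst hM hm, partner_snd hM hm]
  · rw [partner_snd hM hm, partner_fst hM hm]

/-- `partner` preserves the support. [folklore] -/
theorem partner_mem_suppM (hM : IsPartialMatching M) {j : Fin n} (hj : j ∈ suppM M) :
    partner M j ∈ suppM M := by
  obtain ⟨m, hm, rfl | rfl⟩ := mem_suppM.1 hj
  · rw [partner_fst hM hm]; exact mem_suppM.2 ⟨m, hm, Or.inr rfl⟩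
  · rw [partner_snd hM hm]; exact mem_suppM.2 ⟨m, hm, Or.inl rfl⟩

variable (M) in
/-- The sorted pair `{j, partner j}` through `j`. [folklore] -/
def smk (j : Fin n) : Fin n × Fin n := if partner M j < j then (partner M j, j) else (j, partner M j)

/-- The sorted pair through a first endpoint. [folklore] -/
theorem smk_fst (hM : IsPartialMatching M) {m : Fin n × Fin n} (hm : m ∈ M) : smk M m.1 = m := by
  unfold smk
  rw [partner_fst hM hm, if_neg (not_lt.2 (hM.1 m hm).le)]

/-- The sorted pair through a second endpoint. [folklore] -/
theorem smk_snd (hM : IsPartialMatching M) {m : Fin n × Fin n} (hm : m ∈ M) : smk M m.2 = m := by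
  unfold smk
  rw [partner_snd hM hm, if_pos (hM.1 m hm)]

/-- The sorted pair through a supported index is a pair of the matching. [folklore] -/
theorem smk_mem (hM : IsPartialMatching M) {j : Fin n} (hj : j ∈ suppM M) : smk M j ∈ M := by
  obtain ⟨m, hm, rfl | rfl⟩ := mem_suppM.1 hj
  · rw [smk_fst hM hm]; exact hm
  · rw [smk_snd hM hm]; exact hm

variable (M) in
/-- **Transversals** of a set of pairs: subsets of the support meeting every pair in exactly one
endpoint. [folklore] -/
def IsTransversal (P : Finset (Fin n)) : Prop := P ⊆ suppM M ∧ ∀ m ∈ M, (m.1 ∈ P ↔ m.2 ∉ P)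

/-- A transversal contains exactly one of `j`, `partner j`. [folklore] -/
theorem IsTransversal.mem_iff {P : Finset (Fin n)} (hT : IsTransversal M P) (hM : IsPartialMatching M)
    {j : Fin n} (hj : j ∈ suppM M) : j ∈ P ↔ partner M j ∉ P := by
  obtain ⟨m, hm, rfl | rfl⟩ := mem_suppM.1 hj
  · rw [partner_fst hM hm]; exact hT.2 m hm
  · rw [partner_snd hM hm]; have := hT.2 m hm; tauto

/-! ## Orthants of `ℝ^M` and the orthant integrals -/

open scoped Classical in
/-- The orthant indicator of `ℝ^M` selected by `P`: `w_m < 0` if the first endpoint of `m` is in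
`P`, `w_m > 0` otherwise. [folklore] -/
def orthIndMP (M : Finset (Fin n × Fin n)) (P : Finset (Fin n)) (w : ↥M → ℝ) : ℝ :=
  if ∀ m : ↥M, (if (m : Fin n × Fin n).1 ∈ P then w m < 0 else 0 < w m) then 1 else 0

/-- **The orthant integral** `J(M, P, Φ) = ∫_{orthant(P)} Π|w_m| Φ(Σ w_m e_m)`. [cite: RudnickSarnak1996, (3.9)] -/
def Jorth (M : Finset (Fin n × Fin n)) (P : Finset (Fin n)) (Φ : (Fin n → ℝ) → ℂ) : ℂ :=
  ∫ w : ↥M → ℝ, ((orthIndMP M P w * ∏ m, |w m| : ℝ) : ℂ) * Φ (∑ m, w m • rsBasisDiff (m : Fin n × Fin n))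

/-- The orthants are measurable. [folklore] -/
theorem measurableSet_orth (M : Finset (Fin n × Fin n)) (P : Finset (Fin n)) :
    MeasurableSet {w : ↥M → ℝ | ∀ m : ↥M, if (m : Fin n × Fin n).1 ∈ P then w m < 0 else 0 < w m} := by
  rw [Set.setOf_forall]
  refine MeasurableSet.iInter fun m ↦ ?_
  by_cases h : (m : Fin n × Fin n).1 ∈ P
  · simp only [h, if_true]; exact measurableSet_lt (measurable_pi_apply m) measurable_const
  · simp only [h, if_false]; exact measurableSet_lt measurable_const (measurable_pi_apply m)

/-- The orthant piece of an integrand is its indicator restriction. [folklore] -/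
theorem orth_piece_eq_indicator (M : Finset (Fin n × Fin n)) (P : Finset (Fin n)) (F : (↥M → ℝ) → ℂ) :
    (fun w : ↥M → ℝ ↦ ((orthIndMP M P w : ℝ) : ℂ) * F w) =
      {w : ↥M → ℝ | ∀ m : ↥M, if (m : Fin n × Fin n).1 ∈ P then w m < 0 else 0 < w m}.indicator F := by
  funext w
  unfold orthIndMP
  split_ifs with h
  · rw [Set.indicator_of_mem (by exact h), Complex.ofReal_one, one_mul]
  · rw [Set.indicator_of_notMem (by exact h), Complex.ofReal_zero, zero_mul]

/-- Integrability of the orthant pieces. [folklore] -/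
theorem integrable_orth_piece (M : Finset (Fin n × Fin n)) (P : Finset (Fin n)) {F : (↥M → ℝ) → ℂ}
    (hF : Integrable F) : Integrable fun w : ↥M → ℝ ↦ ((orthIndMP M P w : ℝ) : ℂ) * F w := by
  rw [orth_piece_eq_indicator]
  exact hF.indicator (measurableSet_orth M P)

/-- Almost every point of `ℝ^ι` has all coordinates nonzero. [folklore] -/
theorem ae_forall_ne_zero {ι : Type*} [Fintype ι] : ∀ᵐ w : ι → ℝ, ∀ i, w i ≠ 0 := by
  rw [ae_all_iff]
  intro i
  exact Measure.ae_eval_ne (fun _ : ι ↦ (volume : Measure ℝ)) i (0 : ℝ)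

/-- The transversal selected by a point with nonzero coordinates. [folklore] -/
def Pw (M : Finset (Fin n × Fin n)) (w : ↥M → ℝ) : Finset (Fin n) :=
  ((Finset.univ.filter fun m : ↥M ↦ w m < 0).image fun m : ↥M ↦ (m : Fin n × Fin n).1) ∪
    ((Finset.univ.filter fun m : ↥M ↦ 0 < w m).image fun m : ↥M ↦ (m : Fin n × Fin n).2)

/-- `m.1 ∈ P(w) ↔ w_m < 0`. [folklore] -/
theorem fst_mem_Pw_iff (hM : IsPartialMatching M) (w : ↥M → ℝ) (m : ↥M) :
    (m : Fin n × Fin n).1 ∈ Pw M w ↔ w m < 0 := by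
  rw [Pw, Finset.mem_union, Finset.mem_image, Finset.mem_image]
  constructor
  · rintro (⟨m', hm', h⟩ | ⟨m', hm', h⟩)
    · have : m' = m := Subtype.ext (eq_of_endpoint hM m'.2 m.2 (j := (m : Fin n × Fin n).1) (Or.inl h.symm) (Or.inl rfl))
      rw [← this]; exact (Finset.mem_filter.1 hm').2
    · have : m' = m := Subtype.ext (eq_of_endpoint hM m'.2 m.2 (j := (m : Fin n × Fin n).1) (Or.inr h.symm) (Or.inl rfl))
      rw [this] at h
      exact absurd h.symm (fst_ne_snd hM m.2)
  · intro h
    exact Or.inl ⟨m, Finset.mem_filter.2 ⟨Finset.mem_univ _, h⟩, rfl⟩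

/-- `m.2 ∈ P(w) ↔ 0 < w_m`. [folklore] -/
theorem snd_mem_Pw_iff (hM : IsPartialMatching M) (w : ↥M → ℝ) (m : ↥M) :
    (m : Fin n × Fin n).2 ∈ Pw M w ↔ 0 < w m := by
  rw [Pw, Finset.mem_union, Finset.mem_image, Finset.mem_image]
  constructor
  · rintro (⟨m', hm', h⟩ | ⟨m', hm', h⟩)
    · have : m' = m := Subtype.ext (eq_of_endpoint hM m'.2 m.2 (j := (m : Fin n × Fin n).2) (Or.inl h.symm) (Or.inr rfl))
      rw [this] at h
      exact absurd h (fst_ne_snd hM m.2)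
    · have : m' = m := Subtype.ext (eq_of_endpoint hM m'.2 m.2 (j := (m : Fin n × Fin n).2) (Or.inr h.symm) (Or.inr rfl))
      rw [← this]; exact (Finset.mem_filter.1 hm').2
  · intro h
    exact Or.inr ⟨m, Finset.mem_filter.2 ⟨Finset.mem_univ _, h⟩, rfl⟩

/-- `P(w) ⊆ supp M`. [folklore] -/
theorem Pw_subset (w : ↥M → ℝ) : Pw M w ⊆ suppM M := by
  intro j hj
  rw [Pw, Finset.mem_union, Finset.mem_image, Finset.mem_image] at hj
  rcases hj with ⟨m, -, rfl⟩ | ⟨m, -, rfl⟩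
  · exact mem_suppM.2 ⟨m, m.2, Or.inl rfl⟩
  · exact mem_suppM.2 ⟨m, m.2, Or.inr rfl⟩

/-- `P(w)` is a transversal when all coordinates are nonzero. [folklore] -/
theorem isTransversal_Pw (hM : IsPartialMatching M) {w : ↥M → ℝ} (hw : ∀ m, w m ≠ 0) : IsTransversal M (Pw M w) := by
  refine ⟨Pw_subset w, fun m hm ↦ ?_⟩
  rw [fst_mem_Pw_iff hM w ⟨m, hm⟩, snd_mem_Pw_iff hM w ⟨m, hm⟩, not_lt]
  constructor
  · exact le_of_lt
  · intro h; exact lt_of_le_of_ne h (hw ⟨m, hm⟩)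

/-- On a point with nonzero coordinates the orthant indicator of a transversal `P` is `[P = P(w)]`.
[folklore] -/
theorem orthIndMP_eq_ite (hM : IsPartialMatching M) {w : ↥M → ℝ} (hw : ∀ m, w m ≠ 0) {P : Finset (Fin n)}
    (hT : IsTransversal M P) : orthIndMP M P w = if P = Pw M w then 1 else 0 := by
  unfold orthIndMP
  by_cases hP : P = Pw M w
  · rw [if_pos hP, if_pos]
    intro m
    rw [hP]
    by_cases h : w m < 0
    · rw [if_pos ((fst_mem_Pw_iff hM w m).2 h)]; exact h
    · rw [if_neg (fun h' ↦ h ((fst_mem_Pw_iff hM w m).1 h'))]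
      exact lt_of_le_of_ne (not_lt.1 h) (hw m).symm
  · rw [if_neg hP, if_neg]
    intro hcond
    apply hP
    ext j
    constructor
    · intro hjP
      obtain ⟨m, hm, hj⟩ := mem_suppM.1 (hT.1 hjP)
      rcases hj with rfl | rfl
      · have hc := hcond ⟨m, hm⟩
        simp only [hjP, if_true] at hc
        exact (fst_mem_Pw_iff hM w ⟨m, hm⟩).2 hc
      · have h1 : m.1 ∉ P := fun h1 ↦ (hT.2 m hm).1 h1 hjP
        have hc := hcond ⟨m, hm⟩
        simp only [h1, if_false] at hc
        exact (snd_mem_Pw_iff hM w ⟨m, hm⟩).2 hc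
    · intro hjw
      obtain ⟨m, hm, hj⟩ := mem_suppM.1 (Pw_subset w hjw)
      rcases hj with rfl | rfl
      · have hlt := (fst_mem_Pw_iff hM w ⟨m, hm⟩).1 hjw
        by_contra h1
        have hc := hcond ⟨m, hm⟩
        simp only [h1, if_false] at hc
        exact absurd (hlt.trans hc) (lt_irrefl _)
      · have hgt := (snd_mem_Pw_iff hM w ⟨m, hm⟩).1 hjw
        have h1 : m.1 ∉ P := by
          intro h1
          have hc := hcond ⟨m, hm⟩
          simp only [h1, if_true] at hc
          exact absurd (hgt.trans hc) (lt_irrefl _)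
        exact not_not.1 (mt (hT.2 m hm).2 h1)

open scoped Classical in
/-- **The orthants of the transversals partition `ℝ^M`** off the coordinate hyperplanes.
[cite: RudnickSarnak1996, (3.45)–(3.47)] -/
theorem sum_orthIndMP_eq_one (hM : IsPartialMatching M) {w : ↥M → ℝ} (hw : ∀ m, w m ≠ 0) :
    ∑ P ∈ (suppM M).powerset.filter (IsTransversal M), orthIndMP M P w = 1 := by
  rw [Finset.sum_congr rfl fun P hP ↦ orthIndMP_eq_ite hM hw (Finset.mem_filter.1 hP).2, Finset.sum_ite_eq']
  rw [if_pos (Finset.mem_filter.2 ⟨Finset.mem_powerset.2 (Pw_subset w), isTransversal_Pw hM hw⟩)]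

open scoped Classical in
/-- **The orthant integrals of the transversals add up to the full integral.**
[cite: RudnickSarnak1996, (3.9), (3.47)] -/
theorem sum_transversal_Jorth_eq (hM : IsPartialMatching M) (Φ : (Fin n → ℝ) → ℂ)
    (hint : Integrable fun w : ↥M → ℝ ↦ ((∏ m, |w m| : ℝ) : ℂ) * Φ (∑ m, w m • rsBasisDiff (m : Fin n × Fin n))) :
    ∑ P ∈ (suppM M).powerset.filter (IsTransversal M), Jorth M P Φ =
      ∫ w : ↥M → ℝ, ((∏ m, |w m| : ℝ) : ℂ) * Φ (∑ m, w m • rsBasisDiff (m : Fin n × Fin n)) := by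
  unfold Jorth
  have hpiece : ∀ P : Finset (Fin n), (fun w : ↥M → ℝ ↦ ((orthIndMP M P w * ∏ m, |w m| : ℝ) : ℂ) *
      Φ (∑ m, w m • rsBasisDiff (m : Fin n × Fin n))) = fun w ↦ ((orthIndMP M P w : ℝ) : ℂ) *
        (((∏ m, |w m| : ℝ) : ℂ) * Φ (∑ m, w m • rsBasisDiff (m : Fin n × Fin n))) := by
    intro P; funext w; push_cast; ring
  rw [← integral_finsetSum _ (fun P _ ↦ ?_)]
  · refine integral_congr_ae ?_
    filter_upwards [ae_forall_ne_zero (ι := ↥M)] with w hw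
    rw [← Finset.sum_mul, ← Complex.ofReal_sum, ← Finset.sum_mul, sum_orthIndMP_eq_one hM hw, one_mul]
  · rw [hpiece P]
    exact integrable_orth_piece M P hint

/-- The `m.1`-coordinate of `Σ_m w_m e_m` is `w_m`. [folklore] -/
theorem sum_smul_rsBasisDiff_apply_fst (hM : IsPartialMatching M) (w : ↥M → ℝ) (m : ↥M) :
    (∑ m' : ↥M, w m' • rsBasisDiff (m' : Fin n × Fin n)) (m : Fin n × Fin n).1 = w m := by
  rw [Finset.sum_apply, Finset.sum_eq_single m]
  · simp only [Pi.smul_apply, smul_eq_mul, rsBasisDiff, Pi.sub_apply, Pi.single_eq_same,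
      Pi.single_eq_of_ne (fst_ne_snd hM m.2), sub_zero, mul_one]
  · intro m' _ hne
    have h1 : (m : Fin n × Fin n).1 ≠ (m' : Fin n × Fin n).1 := fun h ↦
      hne (Subtype.ext (eq_of_endpoint hM m'.2 m.2 (j := (m : Fin n × Fin n).1) (Or.inl h) (Or.inl rfl)))
    have h2 : (m : Fin n × Fin n).1 ≠ (m' : Fin n × Fin n).2 := fun h ↦
      hne (Subtype.ext (eq_of_endpoint hM m'.2 m.2 (j := (m : Fin n × Fin n).1) (Or.inr h) (Or.inl rfl)))
    simp only [Pi.smul_apply, smul_eq_mul, rsBasisDiff, Pi.sub_apply, Pi.single_eq_of_ne h1,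
      Pi.single_eq_of_ne h2, sub_zero, mul_zero]
  · intro h; exact absurd (Finset.mem_univ m) h

/-- Integrability of the matching integrand for continuous box-supported `Φ`. [folklore] -/
theorem integrable_matching_integrand (hM : IsPartialMatching M) {Φ : (Fin n → ℝ) → ℂ} (hΦc : Continuous Φ)
    (hΦs : ∀ ξ, Φ ξ ≠ 0 → ∀ j, |ξ j| ≤ 2) :
    Integrable fun w : ↥M → ℝ ↦ ((∏ m, |w m| : ℝ) : ℂ) * Φ (∑ m, w m • rsBasisDiff (m : Fin n × Fin n)) := by
  refine Continuous.integrable_of_hasCompactSupport ?_ ?_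
  · exact (Complex.continuous_ofReal.comp (continuous_finsetProd _ fun m _ ↦ (continuous_apply m).abs)).mul
      (hΦc.comp (continuous_finsetSum _ fun m _ ↦ (continuous_apply m).smul continuous_const))
  · refine HasCompactSupport.of_support_subset_isCompact
      (isCompact_univ_pi fun _ : ↥M ↦ (isCompact_Icc : IsCompact (Set.Icc (-2 : ℝ) 2))) ?_
    intro w hw
    rw [Function.mem_support] at hw
    have hΦ : Φ (∑ m, w m • rsBasisDiff (m : Fin n × Fin n)) ≠ 0 := fun h ↦ hw (by rw [h, mul_zero])
    rw [Set.mem_univ_pi]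
    intro m
    have h := hΦs _ hΦ (m : Fin n × Fin n).1
    rw [sum_smul_rsBasisDiff_apply_fst hM w m] at h
    exact Set.mem_Icc.2 (abs_le.1 h)

end Matching

/-! ## Patterns and their matchings -/

section Pattern

variable {D P : Finset (Fin (k + 1))} {β : ↥P ≃ ↥((Finset.univ \ D) \ P)}

variable (D P β) in
/-- The sorted pair `{p, βp}` as `(min, max)`. [folklore] -/
def spair (p : ↥P) : Fin (k + 1) × Fin (k + 1) :=
  if betaF D P β p < (p : Fin (k + 1)) then (betaF D P β p, (p : Fin (k + 1))) else ((p : Fin (k + 1)), betaF D P β p)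

variable (D P β) in
/-- The orientation sign of the pair of `p`: `+1` if `βp < p`. [folklore] -/
def sgnM (p : ↥P) : ℝ := if betaF D P β p < (p : Fin (k + 1)) then 1 else -1

variable (D P β) in
/-- **The partial matching of a pattern** `M(P, β) = {{p, βp} : p ∈ P}`. [cite: RudnickSarnak1996, (3.45)] -/
def Mof : Finset (Fin (k + 1) × Fin (k + 1)) := Finset.univ.image (spair D P β)

/-- `βf p = β p` on `P`. [folklore] -/
theorem betaF_coe (p : ↥P) : betaF D P β p = ((β p : ↥((Finset.univ \ D) \ P)) : Fin (k + 1)) := by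
  unfold betaF; rw [dif_pos p.2]

/-- `p ≠ βp`. [folklore] -/
theorem ne_betaF (p : ↥P) : (p : Fin (k + 1)) ≠ betaF D P β p := fun h ↦
  betaF_not_mem_P p (by rw [← h]; exact p.2)

/-- `sgn_p² = 1`. [folklore] -/
theorem sgnM_mul_self (p : ↥P) : sgnM D P β p * sgnM D P β p = 1 := by
  unfold sgnM; split_ifs <;> norm_num

/-- `sgn_p = ±1`. [folklore] -/
theorem sgnM_eq_or (p : ↥P) : sgnM D P β p = 1 ∨ sgnM D P β p = -1 := by
  unfold sgnM; split_ifs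
  · exact Or.inl rfl
  · exact Or.inr rfl

/-- `sgn_p • e_{spair p} = e_{βp} − e_p`. [folklore] -/
theorem sgnM_smul_rsBasisDiff (p : ↥P) : sgnM D P β p • rsBasisDiff (spair D P β p) = dvec D P β p := by
  unfold sgnM spair dvec rsBasisDiff
  split_ifs with h
  · simp
  · simp [neg_sub]

/-- The components of the sorted pair. [folklore] -/
theorem spair_fst_lt_snd (p : ↥P) : (spair D P β p).1 < (spair D P β p).2 := by
  unfold spair
  split_ifs with h
  · exact h
  · exact lt_of_le_of_ne (not_lt.1 h) (ne_betaF p)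

/-- The endpoints of the sorted pair are `{p, βp}`. [folklore] -/
theorem spair_endpoints (p : ↥P) :
    ({(spair D P β p).1, (spair D P β p).2} : Finset (Fin (k + 1))) = {(p : Fin (k + 1)), betaF D P β p} := by
  unfold spair
  split_ifs
  · exact Finset.pair_comm _ _
  · rfl

/-- The first endpoint of the sorted pair lies in `P` iff the orientation is negative. [folklore] -/
theorem spair_fst_mem_P_iff (p : ↥P) : (spair D P β p).1 ∈ P ↔ ¬ betaF D P β p < (p : Fin (k + 1)) := by
  unfold spair
  split_ifs with h
  · simp only [h, not_true_eq_false, iff_false]; exact betaF_not_mem_P p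
  · simp only [h, not_false_eq_true, iff_true]; exact p.2

/-- The `P`-endpoint of the sorted pair: exactly one endpoint lies in `P`, namely `p`. [folklore] -/
theorem spair_mem_P_iff (p : ↥P) (j : Fin (k + 1)) (hj : j = (spair D P β p).1 ∨ j = (spair D P β p).2) :
    j ∈ P ↔ j = p := by
  have hmem : j ∈ ({(spair D P β p).1, (spair D P β p).2} : Finset (Fin (k + 1))) := by
    rcases hj with h | h <;> simp [h]
  rw [spair_endpoints, Finset.mem_insert, Finset.mem_singleton] at hmem
  rcases hmem with h | h
  · exact ⟨fun _ ↦ h, fun _ ↦ h ▸ p.2⟩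
  · constructor
    · intro hjP; exact absurd (h ▸ hjP) (betaF_not_mem_P p)
    · intro hjp; exact absurd (hjp.symm.trans h) (ne_betaF p)

/-- `p` is an endpoint of its sorted pair. [folklore] -/
theorem self_endpoint_spair (p : ↥P) :
    (p : Fin (k + 1)) = (spair D P β p).1 ∨ (p : Fin (k + 1)) = (spair D P β p).2 := by
  have : (p : Fin (k + 1)) ∈ ({(spair D P β p).1, (spair D P β p).2} : Finset (Fin (k + 1))) := by
    rw [spair_endpoints]; simp
  simpa using this

/-- `βp` is an endpoint of the sorted pair of `p`. [folklore] -/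
theorem betaF_endpoint_spair (p : ↥P) :
    betaF D P β p = (spair D P β p).1 ∨ betaF D P β p = (spair D P β p).2 := by
  have : betaF D P β p ∈ ({(spair D P β p).1, (spair D P β p).2} : Finset (Fin (k + 1))) := by
    rw [spair_endpoints]; simp
  simpa using this

/-- `spair` is injective. [folklore] -/
theorem spair_injective : Function.Injective (spair D P β) := by
  intro p q h
  have hp : (p : Fin (k + 1)) ∈ ({(spair D P β q).1, (spair D P β q).2} : Finset (Fin (k + 1))) := by
    rw [← h, spair_endpoints]; simp
  rw [Finset.mem_insert, Finset.mem_singleton] at hp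
  exact Subtype.ext (((spair_mem_P_iff q p hp).1 p.2))

/-- **`M(P, β)` is a partial matching.** [cite: RudnickSarnak1996, (3.9)] -/
theorem isPartialMatching_Mof : IsPartialMatching (Mof D P β) := by
  constructor
  · intro m hm
    obtain ⟨p, -, rfl⟩ := Finset.mem_image.1 hm
    exact spair_fst_lt_snd p
  · intro m hm m' hm' hne
    obtain ⟨p, -, rfl⟩ := Finset.mem_image.1 (Finset.mem_coe.1 hm)
    obtain ⟨q, -, rfl⟩ := Finset.mem_image.1 (Finset.mem_coe.1 hm')
    have hpq : p ≠ q := fun h ↦ hne (h ▸ rfl)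
    simp only [Function.onFun]
    rw [spair_endpoints, spair_endpoints, Finset.disjoint_left]
    intro j hj hj'
    simp only [Finset.mem_insert, Finset.mem_singleton] at hj hj'
    rcases hj with rfl | rfl <;> rcases hj' with h | h
    · exact hpq (Subtype.ext h)
    · exact betaF_not_mem_P q (h ▸ p.2)
    · exact betaF_not_mem_P p (h.symm ▸ q.2)
    · exact hpq (Subtype.ext (betaF_injOn D P β (Finset.mem_coe.2 p.2) (Finset.mem_coe.2 q.2) h))

/-- **The bijection `P ≃ M(P, β)`.** [folklore] -/
def eM : ↥P ≃ ↥(Mof D P β) :=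
  Equiv.ofBijective (fun p ↦ ⟨spair D P β p, Finset.mem_image_of_mem _ (Finset.mem_univ p)⟩)
    ⟨fun p q h ↦ spair_injective (congrArg Subtype.val h), fun m ↦ by
      obtain ⟨p, -, hp⟩ := Finset.mem_image.1 m.2
      exact ⟨p, Subtype.ext hp⟩⟩

/-- `eM p = spair p`. [folklore] -/
theorem eM_apply (p : ↥P) : ((eM (β := β) p : ↥(Mof D P β)) : Fin (k + 1) × Fin (k + 1)) = spair D P β p := rfl

/-! ### The support and the transversal of a pattern -/

/-- `supp M(P, β) = Dᶜ` (`P ⊆ Dᶜ`). [folklore] -/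
theorem suppM_Mof (hP : P ⊆ Finset.univ \ D) : suppM (Mof D P β) = Finset.univ \ D := by
  ext j
  rw [mem_suppM]
  constructor
  · rintro ⟨m, hm, hj⟩
    obtain ⟨p, -, rfl⟩ := Finset.mem_image.1 hm
    have hmem : j ∈ ({(spair D P β p).1, (spair D P β p).2} : Finset (Fin (k + 1))) := by
      rcases hj with rfl | rfl <;> simp
    rw [spair_endpoints, Finset.mem_insert, Finset.mem_singleton] at hmem
    rcases hmem with rfl | rfl
    · exact hP p.2
    · exact (Finset.mem_sdiff.1 (betaF_mem D P β p.2)).1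
  · intro hj
    by_cases hjP : j ∈ P
    · exact ⟨spair D P β ⟨j, hjP⟩, Finset.mem_image_of_mem _ (Finset.mem_univ _), self_endpoint_spair ⟨j, hjP⟩⟩
    · obtain ⟨p, hp, hpj⟩ := exists_betaF_eq D P β (Finset.mem_sdiff.2 ⟨hj, hjP⟩)
      refine ⟨spair D P β ⟨p, hp⟩, Finset.mem_image_of_mem _ (Finset.mem_univ _), ?_⟩
      have h := betaF_endpoint_spair (D := D) (β := β) ⟨p, hp⟩
      rwa [show betaF D P β (⟨p, hp⟩ : ↥P) = j from hpj] at h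

/-- `D` is the complement of the support of `M(P, β)`. [folklore] -/
theorem eq_sdiff_suppM_Mof (hP : P ⊆ Finset.univ \ D) : D = Finset.univ \ suppM (Mof D P β) := by
  rw [suppM_Mof hP, Finset.sdiff_sdiff_eq_self (Finset.subset_univ D)]

/-- `P` is a transversal of `M(P, β)`. [folklore] -/
theorem isTransversal_Mof (hP : P ⊆ Finset.univ \ D) : IsTransversal (Mof D P β) P := by
  refine ⟨fun j hj ↦ by rw [suppM_Mof hP]; exact hP hj, fun m hm ↦ ?_⟩
  obtain ⟨p, -, rfl⟩ := Finset.mem_image.1 hm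
  rw [spair_mem_P_iff p _ (Or.inl rfl), spair_mem_P_iff p _ (Or.inr rfl)]
  have hne : (spair D P β p).1 ≠ (spair D P β p).2 := (spair_fst_lt_snd p).ne
  constructor
  · intro h1 h2; exact hne (h1.trans h2.symm)
  · intro h2
    rcases self_endpoint_spair (D := D) (β := β) p with h | h
    · exact h.symm
    · exact absurd h.symm h2

/-- **A pattern is determined by its matching**: `M(P, β) = M(P, β') ⟹ β = β'`. [folklore] -/
theorem Mof_injective (β β' : ↥P ≃ ↥((Finset.univ \ D) \ P)) (h : Mof D P β = Mof D P β') : β = β' := by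
  refine Equiv.ext fun p ↦ Subtype.ext ?_
  have hm : spair D P β p ∈ Mof D P β' := h ▸ Finset.mem_image_of_mem _ (Finset.mem_univ p)
  obtain ⟨q, -, hq⟩ := Finset.mem_image.1 hm
  have hend : ({(q : Fin (k + 1)), betaF D P β' q} : Finset (Fin (k + 1))) = {(p : Fin (k + 1)), betaF D P β p} := by
    rw [← spair_endpoints q, ← spair_endpoints p, hq]
  have hpq : (p : Fin (k + 1)) = q := by
    have : (p : Fin (k + 1)) ∈ ({(q : Fin (k + 1)), betaF D P β' q} : Finset (Fin (k + 1))) := by rw [hend]; simp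
    rw [Finset.mem_insert, Finset.mem_singleton] at this
    rcases this with h1 | h1
    · exact h1
    · exact absurd (show betaF D P β' q ∈ P from h1 ▸ p.2) (betaF_not_mem_P q)
  have hb : betaF D P β p = betaF D P β' q := by
    have : betaF D P β p ∈ ({(q : Fin (k + 1)), betaF D P β' q} : Finset (Fin (k + 1))) := by rw [hend]; simp
    rw [Finset.mem_insert, Finset.mem_singleton] at this
    rcases this with h1 | h1
    · exact absurd (show betaF D P β p ∈ P from h1 ▸ q.2) (betaF_not_mem_P p)
    · exact h1
  have hqp : q = p := Subtype.ext hpq.symm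
  rw [hqp, betaF_coe, betaF_coe] at hb
  exact hb

/-- **Every (matching, transversal) comes from a pattern.** [folklore] -/
theorem exists_Mof_eq {M : Finset (Fin (k + 1) × Fin (k + 1))} (hM : IsPartialMatching M)
    (hD : D = Finset.univ \ suppM M) (hT : IsTransversal M P) :
    ∃ β : ↥P ≃ ↥((Finset.univ \ D) \ P), Mof D P β = M := by
  have hUD : Finset.univ \ D = suppM M := by rw [hD, Finset.sdiff_sdiff_eq_self (Finset.subset_univ _)]
  have hmem : ∀ p : ↥P, partner M p ∈ (Finset.univ \ D) \ P := fun p ↦ by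
    rw [Finset.mem_sdiff, hUD]
    exact ⟨partner_mem_suppM hM (hT.1 p.2), (hT.mem_iff hM (hT.1 p.2)).1 p.2⟩
  let f : ↥P → ↥((Finset.univ \ D) \ P) := fun p ↦ ⟨partner M p, hmem p⟩
  have hf : ∀ p : ↥P, ((f p : ↥((Finset.univ \ D) \ P)) : Fin (k + 1)) = partner M p := fun p ↦ rfl
  have hinj : Function.Injective f := by
    intro p q h
    have h' : partner M p = partner M q := by rw [← hf, ← hf, h]
    apply Subtype.ext
    rw [← partner_partner hM (hT.1 p.2), h', partner_partner hM (hT.1 q.2)]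
  have hsurj : Function.Surjective f := by
    intro q
    have hq : (q : Fin (k + 1)) ∈ suppM M ∧ (q : Fin (k + 1)) ∉ P :=
      ⟨Finset.subset_of_eq hUD (Finset.mem_sdiff.1 q.2).1, (Finset.mem_sdiff.1 q.2).2⟩
    have hpP : partner M q ∈ P := by
      by_contra hne
      have h2 := (hT.mem_iff hM (partner_mem_suppM hM hq.1)).2
      rw [partner_partner hM hq.1] at h2
      exact hne (h2 hq.2)
    exact ⟨⟨partner M q, hpP⟩, Subtype.ext (by rw [hf]; exact partner_partner hM hq.1)⟩
  refine ⟨Equiv.ofBijective f ⟨hinj, hsurj⟩, ?_⟩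
  have hb : ∀ p : ↥P, betaF D P (Equiv.ofBijective f ⟨hinj, hsurj⟩) p = partner M p := fun p ↦ by
    rw [betaF_coe]; rfl
  have hsp : ∀ p : ↥P, spair D P (Equiv.ofBijective f ⟨hinj, hsurj⟩) p = smk M p := fun p ↦ by
    unfold spair smk; rw [hb]
  ext m
  simp only [Mof, Finset.mem_image, Finset.mem_univ, true_and, hsp]
  constructor
  · rintro ⟨p, rfl⟩; exact smk_mem hM (hT.1 p.2)
  · intro hm
    by_cases h1 : m.1 ∈ P
    · exact ⟨⟨m.1, h1⟩, smk_fst hM hm⟩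
    · exact ⟨⟨m.2, not_not.1 (mt (hT.2 m hm).2 h1)⟩, smk_snd hM hm⟩

open scoped Classical in
/-- **Patterns ↔ (matching, transversal)**: the number of `β` with `M(P, β) = M` is `1` if
`D = (supp M)ᶜ` and `P` is a transversal of `M`, and `0` otherwise. [cite: RudnickSarnak1996, (3.45)–(3.47)] -/
theorem card_filter_Mof_eq {M : Finset (Fin (k + 1) × Fin (k + 1))} (hM : IsPartialMatching M)
    (D P : Finset (Fin (k + 1))) (hP : P ⊆ Finset.univ \ D) :
    (Finset.univ.filter fun β : ↥P ≃ ↥((Finset.univ \ D) \ P) ↦ Mof D P β = M).card =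
      if D = Finset.univ \ suppM M ∧ IsTransversal M P then 1 else 0 := by
  have hle : (Finset.univ.filter fun β : ↥P ≃ ↥((Finset.univ \ D) \ P) ↦ Mof D P β = M).card ≤ 1 :=
    Finset.card_le_one.2 fun β hβ β' hβ' ↦
      Mof_injective β β' ((Finset.mem_filter.1 hβ).2.trans (Finset.mem_filter.1 hβ').2.symm)
  split_ifs with h
  · obtain ⟨β, hβ⟩ := exists_Mof_eq (D := D) (P := P) hM h.1 h.2
    have hpos : 0 < (Finset.univ.filter fun β : ↥P ≃ ↥((Finset.univ \ D) \ P) ↦ Mof D P β = M).card :=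
      Finset.card_pos.2 ⟨β, Finset.mem_filter.2 ⟨Finset.mem_univ _, hβ⟩⟩
    omega
  · rw [Finset.card_eq_zero, Finset.filter_eq_empty_iff]
    intro β _ hβ
    exact h ⟨hβ ▸ eq_sdiff_suppM_Mof hP, hβ ▸ isTransversal_Mof hP⟩

open scoped Classical in
/-- **Regrouping the patterns with a given matching.** [cite: RudnickSarnak1996, (3.45)–(3.47)] -/
theorem sum_pattern_ite_eq {M : Finset (Fin (k + 1) × Fin (k + 1))} (hM : IsPartialMatching M)
    (J : Finset (Fin (k + 1)) → ℂ) :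
    ∑ D ∈ (Finset.univ : Finset (Fin (k + 1))).powerset, ∑ P ∈ (Finset.univ \ D).powerset,
      ∑ β : ↥P ≃ ↥((Finset.univ \ D) \ P), (if Mof D P β = M then J P else 0) =
        ∑ P ∈ (suppM M).powerset.filter (IsTransversal M), J P := by
  have h1 : ∀ D : Finset (Fin (k + 1)), ∀ P ∈ (Finset.univ \ D).powerset,
      (∑ β : ↥P ≃ ↥((Finset.univ \ D) \ P), (if Mof D P β = M then J P else 0)) =
        if D = Finset.univ \ suppM M ∧ IsTransversal M P then J P else 0 := by
    intro D P hP
    rw [← Finset.sum_filter, Finset.sum_const, card_filter_Mof_eq hM D P (Finset.mem_powerset.1 hP)]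
    split_ifs <;> simp
  rw [Finset.sum_congr rfl fun D _ ↦ Finset.sum_congr rfl (h1 D), Finset.sum_eq_single (Finset.univ \ suppM M)]
  · rw [Finset.sdiff_sdiff_eq_self (Finset.subset_univ _), Finset.sum_filter]
    refine Finset.sum_congr rfl fun P _ ↦ ?_
    simp
  · intro D _ hD
    refine Finset.sum_eq_zero fun P _ ↦ ?_
    rw [if_neg (fun h ↦ hD h.1)]
  · intro h; exact absurd (Finset.mem_powerset.2 (Finset.subset_univ _)) h

/-! ### The cell limit as an orthant integral -/

/-- Coordinatewise sign changes `g ↦ (s_p g_p)_p`, `s_p = ±1`, as a measurable equivalence. [folklore] -/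
def flipVec {ι : Type*} (s : ι → ℝ) (hs : ∀ i, s i = 1 ∨ s i = -1) : (ι → ℝ) ≃ᵐ (ι → ℝ) where
  toFun g i := s i * g i
  invFun g i := s i * g i
  left_inv g := by
    funext i
    have : s i * s i = 1 := by rcases hs i with h | h <;> rw [h] <;> norm_num
    simp only; rw [← mul_assoc, this, one_mul]
  right_inv g := by
    funext i
    have : s i * s i = 1 := by rcases hs i with h | h <;> rw [h] <;> norm_num
    simp only; rw [← mul_assoc, this, one_mul]
  measurable_toFun := measurable_pi_iff.2 fun i ↦ (measurable_pi_apply i).const_mul _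
  measurable_invFun := measurable_pi_iff.2 fun i ↦ (measurable_pi_apply i).const_mul _

/-- `flipVec` is measure preserving. [folklore] -/
theorem measurePreserving_flipVec {ι : Type*} [Fintype ι] (s : ι → ℝ) (hs : ∀ i, s i = 1 ∨ s i = -1) :
    MeasurePreserving (flipVec s hs) := by
  have h : ∀ p : ι, MeasurePreserving (fun x : ℝ ↦ s p * x) := by
    intro p
    rcases hs p with h | h
    · rw [h, show (fun x : ℝ ↦ (1 : ℝ) * x) = id from funext fun x ↦ one_mul x]
      exact MeasurePreserving.id _
    · rw [h, show (fun x : ℝ ↦ (-1 : ℝ) * x) = Neg.neg from funext fun x ↦ neg_one_mul x]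
      exact Measure.measurePreserving_neg _
  exact volume_preserving_pi h

/-- Change of variables `v_p = s_p w_{e p}` for a bijection `e` and signs `s_p = ±1`. [folklore] -/
theorem integral_comp_equiv_sign {ι ι' : Type*} [Fintype ι] [Fintype ι'] (e : ι ≃ ι') (s : ι → ℝ)
    (hs : ∀ i, s i = 1 ∨ s i = -1) (F : (ι → ℝ) → ℂ) :
    ∫ w : ι' → ℝ, F (fun p ↦ s p * w (e p)) = ∫ v : ι → ℝ, F v := by
  have hmp := volume_measurePreserving_piCongrLeft (fun _ : ι' ↦ ℝ) e
  have hA := hmp.integral_comp (MeasurableEquiv.measurableEmbedding _)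
    (fun w : ι' → ℝ ↦ F (fun p ↦ s p * w (e p)))
  rw [← hA]
  have happ : ∀ (g : ι → ℝ) (p : ι),
      (MeasurableEquiv.piCongrLeft (fun _ : ι' ↦ ℝ) e) g (e p) = g p :=
    fun g p ↦ MeasurableEquiv.piCongrLeft_apply_apply (β := fun _ ↦ ℝ) _ g p
  simp_rw [happ]
  exact (measurePreserving_flipVec s hs).integral_comp (flipVec s hs).measurableEmbedding F

/-- The orthant weight in the matching coordinates. [folklore] -/
theorem orthProd_sign_eq (w : ↥(Mof D P β) → ℝ) :
    orthProd (fun p : ↥P ↦ sgnM D P β p * w (eM (β := β) p)) = orthIndMP (Mof D P β) P w * ∏ m, |w m| := by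
  classical
  have hpt : ∀ p : ↥P, 0 < sgnM D P β p * w (eM (β := β) p) ↔
      (if (spair D P β p).1 ∈ P then w (eM (β := β) p) < 0 else 0 < w (eM (β := β) p)) := by
    intro p
    by_cases h : betaF D P β p < (p : Fin (k + 1))
    · have h1 : (spair D P β p).1 ∉ P := fun h' ↦ (spair_fst_mem_P_iff p).1 h' h
      rw [if_neg h1]; unfold sgnM; rw [if_pos h, one_mul]
    · have h1 : (spair D P β p).1 ∈ P := (spair_fst_mem_P_iff p).2 h
      rw [if_pos h1]; unfold sgnM; rw [if_neg h, neg_one_mul, neg_pos]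
  have hiff : (∀ p : ↥P, 0 < sgnM D P β p * w (eM (β := β) p)) ↔
      ∀ m : ↥(Mof D P β), (if (m : Fin (k + 1) × Fin (k + 1)).1 ∈ P then w m < 0 else 0 < w m) := by
    constructor
    · intro h m
      obtain ⟨p, rfl⟩ := (eM (β := β)).surjective m
      rw [eM_apply]; exact (hpt p).1 (h p)
    · intro h p
      exact (hpt p).2 (eM_apply (β := β) p ▸ h (eM (β := β) p))
  unfold orthProd orthIndMP
  by_cases h : ∀ p : ↥P, 0 < sgnM D P β p * w (eM (β := β) p)
  · rw [if_pos h, if_pos (hiff.1 h), one_mul]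
    calc ∏ p : ↥P, sgnM D P β p * w (eM (β := β) p) = ∏ p : ↥P, |w (eM (β := β) p)| := by
          refine Finset.prod_congr rfl fun p _ ↦ ?_
          rw [← abs_of_pos (h p), abs_mul]
          rcases sgnM_eq_or (D := D) (β := β) p with h1 | h1 <;> rw [h1] <;> simp
      _ = ∏ m : ↥(Mof D P β), |w m| := Equiv.prod_comp (eM (β := β)) (fun m ↦ |w m|)
  · rw [if_neg h, if_neg (fun h' ↦ h (hiff.2 h')), zero_mul]

/-- The argument of `Φ` in the matching coordinates. [folklore] -/
theorem sum_sign_smul_dvec_eq (w : ↥(Mof D P β) → ℝ) :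
    ∑ p : ↥P, (sgnM D P β p * w (eM (β := β) p)) • dvec D P β p =
      ∑ m : ↥(Mof D P β), w m • rsBasisDiff (m : Fin (k + 1) × Fin (k + 1)) := by
  calc ∑ p : ↥P, (sgnM D P β p * w (eM (β := β) p)) • dvec D P β p
      = ∑ p : ↥P, w (eM (β := β) p) • rsBasisDiff ((eM (β := β) p : ↥(Mof D P β)) : Fin (k + 1) × Fin (k + 1)) := by
        refine Finset.sum_congr rfl fun p _ ↦ ?_
        rw [← sgnM_smul_rsBasisDiff, smul_smul, eM_apply, mul_comm (sgnM D P β p) (w _), mul_assoc,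
          sgnM_mul_self, mul_one]
    _ = ∑ m : ↥(Mof D P β), w m • rsBasisDiff (m : Fin (k + 1) × Fin (k + 1)) :=
        Equiv.sum_comp (eM (β := β)) (fun m ↦ w m • rsBasisDiff (m : Fin (k + 1) × Fin (k + 1)))

/-- **The cell limit is the orthant integral of its matching**: `I_β(Φ) = J(M(P, β), P, Φ)` (`P ⊆ Dᶜ`).
[cite: RudnickSarnak1996, (3.74)] -/
theorem pairInt_eq_Jorth (hP : P ⊆ Finset.univ \ D) (Φ : (Fin (k + 1) → ℝ) → ℂ) :
    pairInt D P β Φ = Jorth (Mof D P β) P Φ := by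
  rw [pairInt_eq_integral_pairs hP, Jorth, ← integral_comp_equiv_sign (eM (β := β)) (sgnM D P β) sgnM_eq_or
    (fun v ↦ ((orthProd v : ℝ) : ℂ) * Φ (∑ p, v p • dvec D P β p))]
  refine integral_congr_ae (Eventually.of_forall fun w ↦ ?_)
  simp only
  rw [orthProd_sign_eq, sum_sign_smul_dvec_eq]

end Pattern

/-! ## The sum over patterns is `∫ Φ C_O` -/

open scoped Classical in
/-- **The sum of the cell limits over all patterns is the diagonal-pairing functional (3.9)**:
`Σ_D Σ_{P ⊆ Dᶜ} Σ_{β : P ≃ Dᶜ∖P} I_β(Φ) = ∫ Φ C_O`, for every `Φ` whose matching integrands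
`Π|w_m| Φ(Σ w_m e_m)` are integrable. [cite: RudnickSarnak1996, (3.9), (3.45)–(3.47), (3.74)] -/
theorem sum_pairInt_eq_rsPairingFunctional (Φ : (Fin (k + 1) → ℝ) → ℂ)
    (hint : ∀ M : Finset (Fin (k + 1) × Fin (k + 1)), IsPartialMatching M →
      Integrable fun w : ↥M → ℝ ↦ ((∏ m, |w m| : ℝ) : ℂ) * Φ (∑ m, w m • rsBasisDiff (m : Fin (k + 1) × Fin (k + 1)))) :
    ∑ D ∈ (Finset.univ : Finset (Fin (k + 1))).powerset, ∑ P ∈ (Finset.univ \ D).powerset,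
      ∑ β : ↥P ≃ ↥((Finset.univ \ D) \ P), pairInt D P β Φ = rsPairingFunctional (k + 1) Φ := by
  set PM := (Finset.univ : Finset (Finset (Fin (k + 1) × Fin (k + 1)))).filter IsPartialMatching with hPM
  have h1 : ∀ D : Finset (Fin (k + 1)), ∀ P ∈ (Finset.univ \ D).powerset, ∀ β : ↥P ≃ ↥((Finset.univ \ D) \ P),
      pairInt D P β Φ = ∑ M ∈ PM, (if Mof D P β = M then Jorth M P Φ else 0) := by
    intro D P hP β
    rw [Finset.sum_ite_eq, if_pos (Finset.mem_filter.2 ⟨Finset.mem_univ _, isPartialMatching_Mof⟩)]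
    exact pairInt_eq_Jorth (Finset.mem_powerset.1 hP) Φ
  calc ∑ D ∈ (Finset.univ : Finset (Fin (k + 1))).powerset, ∑ P ∈ (Finset.univ \ D).powerset,
        ∑ β : ↥P ≃ ↥((Finset.univ \ D) \ P), pairInt D P β Φ
      = ∑ D ∈ (Finset.univ : Finset (Fin (k + 1))).powerset, ∑ P ∈ (Finset.univ \ D).powerset,
          ∑ β : ↥P ≃ ↥((Finset.univ \ D) \ P), ∑ M ∈ PM, (if Mof D P β = M then Jorth M P Φ else 0) :=
        Finset.sum_congr rfl fun D _ ↦ Finset.sum_congr rfl fun P hP ↦ Finset.sum_congr rfl fun β _ ↦ h1 D P hP β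
    _ = ∑ M ∈ PM, ∑ D ∈ (Finset.univ : Finset (Fin (k + 1))).powerset, ∑ P ∈ (Finset.univ \ D).powerset,
          ∑ β : ↥P ≃ ↥((Finset.univ \ D) \ P), (if Mof D P β = M then Jorth M P Φ else 0) := by
        refine (Finset.sum_congr rfl fun D _ ↦ ?_).trans Finset.sum_comm
        exact (Finset.sum_congr rfl fun P _ ↦ Finset.sum_comm).trans Finset.sum_comm
    _ = ∑ M ∈ PM, ∑ P ∈ (suppM M).powerset.filter (IsTransversal M), Jorth M P Φ :=
        Finset.sum_congr rfl fun M hM ↦ sum_pattern_ite_eq (Finset.mem_filter.1 hM).2 _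
    _ = rsPairingFunctional (k + 1) Φ := by
        unfold rsPairingFunctional
        exact Finset.sum_congr rfl fun M hM ↦
          sum_transversal_Jorth_eq (Finset.mem_filter.1 hM).2 Φ (hint M (Finset.mem_filter.1 hM).2)

/-- **The front-end limit functional is `∫ Φ C_O`** for continuous `Φ` supported in the box
`|ξ_j| ≤ 2`. [cite: RudnickSarnak1996, (3.9), (3.74)] -/
theorem frontLimit_eq_rsPairingFunctional {Φ : (Fin (k + 1) → ℝ) → ℂ} (hΦc : Continuous Φ)
    (hΦs : ∀ ξ, Φ ξ ≠ 0 → ∀ j, |ξ j| ≤ 2) : Unsmooth.frontLimit k Φ = rsPairingFunctional (k + 1) Φ := by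
  unfold Unsmooth.frontLimit
  exact sum_pairInt_eq_rsPairingFunctional Φ fun M hM ↦ integrable_matching_integrand hM hΦc hΦs

/-- **The limit of the windowed sums is `c_n ∫ Φ C_O`** (Rudnick–Sarnak 1996, Thm. 3.1 in the
`t`-windowed form; RH): for an admissible `Φ` at level `n = k + 1`,
`W_Φ(T) / (T log T) → c_n ∫ Φ C_O`, `c_n = (2π)⁻¹ ∫ κⁿ`. [cite: RudnickSarnak1996, Thm. 3.1, (3.9)] -/
theorem tendsto_zeroSideSum_div_rsPairing (hRH : RiemannHypothesis) {Φ : (Fin (k + 1) → ℝ) → ℂ}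
    (hΦ : IsRSAdmissiblePhi k Φ) :
    Tendsto (fun T : ℝ ↦ zeroSideSum Φ T / ((T : ℂ) * (Real.log T : ℂ))) atTop
      (𝓝 ((levelConst (k + 1) : ℂ) * rsPairingFunctional (k + 1) Φ)) := by
  rw [← frontLimit_eq_rsPairingFunctional hΦ.contDiff.continuous (Unsmooth.admissible_box hΦ)]
  exact Unsmooth.tendsto_zeroSideSum_div_mul_log hRH hΦ

end RudnickSarnakN

end Literature.NumberTheory.LFunctions

end
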